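import Summits.ValiantsHypothesis.ValiantsHypothesis.Theorems.GrenetZeonDualUnipotentThreeHalvesLongMassBipartiteGraft
import Summits.ValiantsHypothesis.ValiantsHypothesis.Theorems.GrenetZeonDualUnipotentThreeHalvesLongMassGauge

/-!
# `GrenetZeon.DualUnipotentThreeHalves` (stmt-ValiantsHypothesis-24318), stub (c) `SlowCore.LongMassSlowLawInv` —
# the GRAFT is PRICE-NEUTRAL: `RelCert n k N P → RelCert n m (graft T N s) (P + 2n + 1)` (window currency, by name)

leafhand-val-grenetzeon-2 gen28 (29th hand), 2026-09-01; sequel to ✓ `…LongMassBipartiteGraft` (p843376/p843382: the graft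
`[[0,T,0],[s·1,0,T+N],[0,−s·1,0]]` is nilpotent for EVERY `T`, long, fat and irreducible).  Here the species is PRICED in the tree's
currency ✓ `SlowCore.Ledger` / `SlowCore.RelCert` (p680269 `…SlowCoreLedger`):

* §1 rectangular degree bookkeeping (`deg_mul_le`, `deg_smul_le`, `deg_fromBlocks_le`, …) and the pure estimate `deg_graft_pow_le`: if the
  entries of `T, N` have degree `≤ 1`, `s = C c` is a constant and every power `N^a`, `a ≤ b`, has entries of degree `≤ k_N`, then EVERY entry of
  `graft(T,N,C c)^b` has degree `≤ k_N + 2` — by the closed forms ✓ `graft_pow_even_succ` / `graft_pow_odd` (a power of `N` dressed by at most one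
  `P = [T ; −s·1]` and one `Q = [s·1 | T+N]`).
* §2 the PENCIL-LEVEL graft `G = reindex e e (fromBlocks 0 (fromCols (sp • 1) (Tp + Np)) (fromRows Tp (-(sp • 1))) 0) : AffMat n m` of affine pencils
  `Tp, Np : AffMat n k`, an affine scalar `sp` and ANY re-indexing `e : Fin k ⊕ (Fin k ⊕ Fin k) ≃ Fin m` (def-free: `G` and the equation `hG` are
  hypotheses): `isAffine_graft`; `graft_pencil_pow_eq_zero` (`Np^j = 0, 2j+1 ≤ p ⇒ G^p = 0`); `graft_map_lineSubst` (line substitution commutes with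
  the construction); ★ `ledger_graft`: a whole-pencil window ledger `(K, k_N)` of `Np` gives the ledger `(K ⊓ frozenDir sp, k_N + 2)` of `G`;
  ★★ `relCert_graft : RelCert n k Np P → RelCert n m G (P + 2·n + 1)`.

READING (census `Cruxes/DualUnipotentThreeHalves/CENSUS-leafhand2-g28-bipartite-graft.md` §2): grafting manufactures irreducibility, `k²` fat
directions and doubles the index at the cost of `2n + 1` in price — the `T`-directions are universally SLOW.  With `Np` valued in `𝔫_k`
(✓ `relCert_of_triangularisable_two`, price `≤ 2⌊√n⌋k`) the fat ∧ long ∧ irreducible graft space is CHEAP: it is NOT a (c)-violator, and a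
(c)-violator must have FAT FAST directions at every order (portrait line).  Through ✓ `PerPencilPrice.le_of_relCert_of_perPoly_eq_trace` every priced
species is at once an 8062/24318 exclusion: no `per_n = tr(G^{n−1}M)` with `G` a graft over a pencil of price `P` unless `P + 2n + 1 ≥ n(n−1)`.

Honest framing.  Helper (`--supports stmt-ValiantsHypothesis-24318`); nothing here proves (c), S3, 24318, 8062 or `VP ≠ VNP` — all OPEN / NOT
proved.  No definitions, no sorry, standard axioms. [folklore degree bookkeeping; construction of this hand]
-/

set_option linter.dupNamespace false
set_option autoImplicit false

namespace Summit.ValiantsHypothesis.ValiantsHypothesis.Theorems.GrenetZeon.BipartiteGraft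

open MvPolynomial Matrix
open scoped BigOperators
open Summit.ValiantsHypothesis.ValiantsHypothesis.Cruxes.TwoDimCoefficients.DimTwoCases (AffMat IsAffine)
open Summit.ValiantsHypothesis.ValiantsHypothesis.Theorems.GrenetZeon.RadicalSplit (lineSubst)
open Summit.ValiantsHypothesis.ValiantsHypothesis.Theorems.GrenetZeon.SlowCore (Ledger RelCert finrank_dir_le)
open Summit.ValiantsHypothesis.ValiantsHypothesis.Theorems.GrenetZeon.GaugeRow
  (frozenDir finrank_frozenDir lineSubst_of_frozen totalDegree_lineSubst_le_one)

/-! ## §1 Rectangular degree bookkeeping and the pure estimate -/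

section Deg

variable {σ : Type*} {ι κ μ : Type*}

/-- Entrywise total degree of a product of (rectangular) polynomial matrices. [folklore] -/
theorem deg_mul_le [Fintype κ] {M : Matrix ι κ (MvPolynomial σ ℂ)} {N : Matrix κ μ (MvPolynomial σ ℂ)} {d₁ d₂ : ℕ}
    (hM : ∀ i j, (M i j).totalDegree ≤ d₁) (hN : ∀ i j, (N i j).totalDegree ≤ d₂) (i : ι) (j : μ) :
    ((M * N) i j).totalDegree ≤ d₁ + d₂ := by
  rw [Matrix.mul_apply]
  refine (totalDegree_finsetSum _ _).trans (Finset.sup_le fun k _ => ?_)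
  exact (totalDegree_mul _ _).trans (Nat.add_le_add (hM i k) (hN k j))

/-- Entrywise total degree of a scalar multiple. [folklore] -/
theorem deg_smul_le {M : Matrix ι κ (MvPolynomial σ ℂ)} {a : MvPolynomial σ ℂ} {d₀ d : ℕ}
    (ha : a.totalDegree ≤ d₀) (hM : ∀ i j, (M i j).totalDegree ≤ d) (i : ι) (j : κ) :
    ((a • M) i j).totalDegree ≤ d₀ + d := by
  rw [Matrix.smul_apply, smul_eq_mul]
  exact (totalDegree_mul _ _).trans (Nat.add_le_add ha (hM i j))

/-- Entrywise total degree of a sum. [folklore] -/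
theorem deg_add_le {M N : Matrix ι κ (MvPolynomial σ ℂ)} {d : ℕ}
    (hM : ∀ i j, (M i j).totalDegree ≤ d) (hN : ∀ i j, (N i j).totalDegree ≤ d) (i : ι) (j : κ) :
    ((M + N) i j).totalDegree ≤ d := by
  rw [Matrix.add_apply]
  exact (totalDegree_add _ _).trans (max_le (hM i j) (hN i j))

/-- Entrywise total degree of a negation. [folklore] -/
theorem deg_neg_le {M : Matrix ι κ (MvPolynomial σ ℂ)} {d : ℕ} (hM : ∀ i j, (M i j).totalDegree ≤ d) (i : ι) (j : κ) :
    ((-M) i j).totalDegree ≤ d := by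
  rw [Matrix.neg_apply, totalDegree_neg]
  exact hM i j

/-- Entries of the zero matrix have degree `0`. [folklore] -/
theorem deg_zero_le (d : ℕ) (i : ι) (j : κ) : ((0 : Matrix ι κ (MvPolynomial σ ℂ)) i j).totalDegree ≤ d := by
  rw [Matrix.zero_apply, totalDegree_zero]
  exact Nat.zero_le _

/-- Entries of a constant multiple of the identity have degree `0`. [folklore] -/
theorem deg_smul_one_le [DecidableEq ι] (c : ℂ) (d : ℕ) (i j : ι) :
    (((C c : MvPolynomial σ ℂ) • (1 : Matrix ι ι (MvPolynomial σ ℂ))) i j).totalDegree ≤ d := by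
  rw [Matrix.smul_apply, Matrix.one_apply, smul_eq_mul]
  split_ifs
  · rw [mul_one, totalDegree_C]; exact Nat.zero_le _
  · rw [mul_zero, totalDegree_zero]; exact Nat.zero_le _

/-- Entries of the identity have degree `0`. [folklore] -/
theorem deg_one_le [DecidableEq ι] (d : ℕ) (i j : ι) : ((1 : Matrix ι ι (MvPolynomial σ ℂ)) i j).totalDegree ≤ d := by
  rw [Matrix.one_apply]
  split_ifs
  · rw [totalDegree_one]; exact Nat.zero_le _
  · rw [totalDegree_zero]; exact Nat.zero_le _

/-- Entrywise degree of a block matrix. [folklore] -/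
theorem deg_fromBlocks_le {l m : Type*} {A : Matrix l l (MvPolynomial σ ℂ)} {B : Matrix l m (MvPolynomial σ ℂ)}
    {C' : Matrix m l (MvPolynomial σ ℂ)} {D : Matrix m m (MvPolynomial σ ℂ)} {d : ℕ}
    (hA : ∀ i j, (A i j).totalDegree ≤ d) (hB : ∀ i j, (B i j).totalDegree ≤ d)
    (hC : ∀ i j, (C' i j).totalDegree ≤ d) (hD : ∀ i j, (D i j).totalDegree ≤ d) (i j : l ⊕ m) :
    ((fromBlocks A B C' D) i j).totalDegree ≤ d := by
  rcases i with i | i <;> rcases j with j | j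
  · rw [fromBlocks_apply₁₁]; exact hA i j
  · rw [fromBlocks_apply₁₂]; exact hB i j
  · rw [fromBlocks_apply₂₁]; exact hC i j
  · rw [fromBlocks_apply₂₂]; exact hD i j

/-- Entrywise degree of a row-partitioned matrix. [folklore] -/
theorem deg_fromRows_le {l m : Type*} {A : Matrix l κ (MvPolynomial σ ℂ)} {B : Matrix m κ (MvPolynomial σ ℂ)} {d : ℕ}
    (hA : ∀ i j, (A i j).totalDegree ≤ d) (hB : ∀ i j, (B i j).totalDegree ≤ d) (i : l ⊕ m) (j : κ) :
    ((fromRows A B) i j).totalDegree ≤ d := by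
  rcases i with i | i
  · rw [fromRows_apply_inl]; exact hA i j
  · rw [fromRows_apply_inr]; exact hB i j

/-- Entrywise degree of a column-partitioned matrix. [folklore] -/
theorem deg_fromCols_le {l m : Type*} {A : Matrix ι l (MvPolynomial σ ℂ)} {B : Matrix ι m (MvPolynomial σ ℂ)} {d : ℕ}
    (hA : ∀ i j, (A i j).totalDegree ≤ d) (hB : ∀ i j, (B i j).totalDegree ≤ d) (i : ι) (j : l ⊕ m) :
    ((fromCols A B) i j).totalDegree ≤ d := by
  rcases j with j | j
  · rw [fromCols_apply_inl]; exact hA i j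
  · rw [fromCols_apply_inr]; exact hB i j

/-- ★ **The pure estimate.**  If `T, N` have entries of degree `≤ 1`, the scalar is a constant `C c`, and every power `N^a`, `a ≤ b`, has entries
of degree `≤ k_N`, then every entry of `graft(T, N, C c)^b` has degree `≤ k_N + 2` (closed forms: a power of `N` dressed by at most one
`P = [T ; −C c·1]` on the left and one `Q = [C c·1 | T+N]` on the right, both of degree `≤ 1`). [folklore] -/
theorem deg_graft_pow_le [Fintype ι] [DecidableEq ι] (T N : Matrix ι ι (MvPolynomial σ ℂ)) (c : ℂ) (kN b : ℕ)
    (hT : ∀ i j, (T i j).totalDegree ≤ 1) (hN1 : ∀ i j, (N i j).totalDegree ≤ 1)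
    (hN : ∀ a, a ≤ b → ∀ i j, ((N ^ a) i j).totalDegree ≤ kN) (I J : ι ⊕ (ι ⊕ ι)) :
    (((fromBlocks 0 (fromCols ((C c : MvPolynomial σ ℂ) • (1 : Matrix ι ι (MvPolynomial σ ℂ))) (T + N))
        (fromRows T (-((C c : MvPolynomial σ ℂ) • (1 : Matrix ι ι (MvPolynomial σ ℂ))))) 0) ^ b) I J).totalDegree ≤ kN + 2 := by
  have hP : ∀ i j, ((fromRows T (-((C c : MvPolynomial σ ℂ) • (1 : Matrix ι ι (MvPolynomial σ ℂ))))) i j).totalDegree ≤ 1 :=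
    deg_fromRows_le hT (deg_neg_le (deg_smul_one_le c 1))
  have hQ : ∀ i j, ((fromCols ((C c : MvPolynomial σ ℂ) • (1 : Matrix ι ι (MvPolynomial σ ℂ))) (T + N)) i j).totalDegree ≤ 1 :=
    deg_fromCols_le (deg_smul_one_le c 1) (deg_add_le hT hN1)
  have hsN : ∀ a, a ≤ b → ∀ i j, ((((-C c : MvPolynomial σ ℂ) ^ a) • N ^ a) i j).totalDegree ≤ kN := by
    intro a ha i j
    have h0 : ((-C c : MvPolynomial σ ℂ) ^ a).totalDegree ≤ 0 := by
      rw [← C_neg, ← C_pow, totalDegree_C]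
    simpa using deg_smul_le h0 (hN a ha) i j
  obtain ⟨j, rfl | rfl⟩ := Nat.even_or_odd' b
  · cases j with
    | zero =>
      rw [Nat.mul_zero, pow_zero]
      exact deg_one_le _ I J
    | succ j =>
      rw [show 2 * (j + 1) = 2 * j + 2 by ring, graft_pow_even_succ]
      refine deg_fromBlocks_le ?_ (deg_zero_le _) (deg_zero_le _) ?_ I J
      · intro i l
        exact (hsN (j + 1) (by omega) i l).trans (by omega)
      · intro i l
        exact (deg_mul_le (deg_mul_le hP (hsN j (by omega))) hQ i l).trans (by omega)
  · rw [graft_pow_odd]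
    refine deg_fromBlocks_le (deg_zero_le _) ?_ ?_ (deg_zero_le _) I J
    · intro i l
      exact (deg_mul_le (hsN j (by omega)) hQ i l).trans (by omega)
    · intro i l
      exact (deg_mul_le hP (hsN j (by omega)) i l).trans (by omega)

end Deg

/-! ## §2 The pencil-level graft and its price -/

section Reindex

variable {A : Type*} [CommRing A] {ι κ : Type*} [Fintype ι] [DecidableEq ι] [Fintype κ] [DecidableEq κ]

/-- Powers commute with re-indexing along an equivalence. [folklore] -/
theorem reindex_pow (e : ι ≃ κ) (M : Matrix ι ι A) (b : ℕ) :
    (Matrix.reindex e e M) ^ b = Matrix.reindex e e (M ^ b) := by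
  induction b with
  | zero => rw [pow_zero, pow_zero, Matrix.reindex_apply, Matrix.submatrix_one_equiv]
  | succ b ih =>
    rw [pow_succ, pow_succ, ih, Matrix.reindex_apply, Matrix.reindex_apply, Matrix.reindex_apply,
      Matrix.submatrix_mul_equiv]

end Reindex

section SmulOneMap

variable {R A B : Type*} [CommSemiring R] [CommSemiring A] [CommSemiring B] [Algebra R A] [Algebra R B]
  {ι : Type*} [DecidableEq ι]

/-- An algebra map sends `s·1` to `φ(s)·1` entrywise. [folklore] -/
theorem smul_one_map (φ : A →ₐ[R] B) (s : A) :
    (s • (1 : Matrix ι ι A)).map φ = φ s • (1 : Matrix ι ι B) := by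
  ext i j
  rw [Matrix.map_apply, Matrix.smul_apply, Matrix.smul_apply, Matrix.one_apply, Matrix.one_apply, smul_eq_mul,
    smul_eq_mul]
  split_ifs
  · rw [mul_one, mul_one]
  · rw [mul_zero, mul_zero, map_zero]

end SmulOneMap

section Pencil

variable {n k m : ℕ} (e : Fin k ⊕ (Fin k ⊕ Fin k) ≃ Fin m) (Tp Np : AffMat n k) (sp : MvPolynomial (Fin n × Fin n) ℂ)

/-- **The pencil-level graft is affine** when `Tp, Np` are affine and `sp` has degree `≤ 1`. -/
theorem isAffine_graft (hT : IsAffine Tp) (hNa : IsAffine Np) (hs : sp.totalDegree ≤ 1) (G : AffMat n m)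
    (hG : G = Matrix.reindex e e (fromBlocks 0
      (fromCols (sp • (1 : Matrix (Fin k) (Fin k) (MvPolynomial (Fin n × Fin n) ℂ))) (Tp + Np))
      (fromRows Tp (-(sp • (1 : Matrix (Fin k) (Fin k) (MvPolynomial (Fin n × Fin n) ℂ))))) 0)) :
    IsAffine G := by
  intro i j
  rw [hG, Matrix.reindex_apply, Matrix.submatrix_apply]
  have hs1 : ∀ a b : Fin k, ((sp • (1 : Matrix (Fin k) (Fin k) (MvPolynomial (Fin n × Fin n) ℂ))) a b).totalDegree ≤ 1 := by
    intro a b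
    rw [Matrix.smul_apply, Matrix.one_apply, smul_eq_mul]
    split_ifs
    · rw [mul_one]; exact hs
    · rw [mul_zero, totalDegree_zero]; exact Nat.zero_le _
  exact deg_fromBlocks_le (deg_zero_le _) (deg_fromCols_le hs1 (deg_add_le hT hNa))
    (deg_fromRows_le hT (deg_neg_le hs1)) (deg_zero_le _) _ _

/-- **The pencil-level graft is nilpotent**: `Np^j = 0` and `2j + 1 ≤ p` give `G^p = 0` (so `G^m = 0` for `m = 3k ≥ 2j+1`). -/
theorem graft_pencil_pow_eq_zero {j p : ℕ} (hN : Np ^ j = 0) (hp : 2 * j + 1 ≤ p) (G : AffMat n m)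
    (hG : G = Matrix.reindex e e (fromBlocks 0
      (fromCols (sp • (1 : Matrix (Fin k) (Fin k) (MvPolynomial (Fin n × Fin n) ℂ))) (Tp + Np))
      (fromRows Tp (-(sp • (1 : Matrix (Fin k) (Fin k) (MvPolynomial (Fin n × Fin n) ℂ))))) 0)) :
    G ^ p = 0 := by
  rw [hG, reindex_pow, graft_pow_eq_zero_of_le Tp Np sp hN hp]
  simp

/-- Line substitution commutes with the graft construction. -/
theorem graft_map_lineSubst (x v : Fin n × Fin n → ℂ) :
    (fromBlocks 0 (fromCols (sp • (1 : Matrix (Fin k) (Fin k) (MvPolynomial (Fin n × Fin n) ℂ))) (Tp + Np))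
        (fromRows Tp (-(sp • (1 : Matrix (Fin k) (Fin k) (MvPolynomial (Fin n × Fin n) ℂ))))) 0).map (lineSubst x v)
      = fromBlocks 0 (fromCols ((lineSubst x v sp) • (1 : Matrix (Fin k) (Fin k) (MvPolynomial (Fin 1) ℂ)))
          (Tp.map (lineSubst x v) + Np.map (lineSubst x v)))
        (fromRows (Tp.map (lineSubst x v)) (-((lineSubst x v sp) • (1 : Matrix (Fin k) (Fin k) (MvPolynomial (Fin 1) ℂ))))) 0 := by
  rw [fromBlocks_map, fromCols_map, fromRows_map, Matrix.map_zero _ (map_zero _), Matrix.map_zero _ (map_zero _),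
    Matrix.map_add _ (map_add _), Matrix.map_neg _ (map_neg _), smul_one_map]

variable {e Tp Np sp}

/-- ★ **LEDGER OF THE GRAFT.**  A whole-pencil window ledger `(K, k_N)` of `Np` yields the ledger `(K ⊓ frozenDir sp, k_N + 2)` of the graft:
along a direction of `K` freezing `sp`, every power in the window is a power of `Np(x+sv)` (degree `≤ k_N`) dressed by at most two affine factors. -/
theorem ledger_graft {K : Submodule ℂ (Fin n × Fin n → ℂ)} {kN : ℕ} (hT : IsAffine Tp) (hNa : IsAffine Np)
    (hs : sp.totalDegree ≤ 1) (hL : Ledger n k Np (fun _ => True) K kN) (G : AffMat n m)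
    (hG : G = Matrix.reindex e e (fromBlocks 0
      (fromCols (sp • (1 : Matrix (Fin k) (Fin k) (MvPolynomial (Fin n × Fin n) ℂ))) (Tp + Np))
      (fromRows Tp (-(sp • (1 : Matrix (Fin k) (Fin k) (MvPolynomial (Fin n × Fin n) ℂ))))) 0)) :
    Ledger n m G (fun _ => True) (K ⊓ frozenDir sp) (kN + 2) := by
  intro x v hv b hb i j _ _
  obtain ⟨hvK, hvF⟩ := Submodule.mem_inf.mp hv
  rw [hG, Matrix.reindex_apply, ← Matrix.submatrix_map, graft_map_lineSubst, lineSubst_of_frozen x v hs hvF,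
    ← Matrix.reindex_apply, reindex_pow, Matrix.reindex_apply, Matrix.submatrix_apply]
  refine deg_graft_pow_le _ _ (eval x sp) kN b ?_ ?_ ?_ _ _
  · intro a c
    rw [Matrix.map_apply]
    exact totalDegree_lineSubst_le_one x v (hT a c)
  · intro a c
    rw [Matrix.map_apply]
    exact totalDegree_lineSubst_le_one x v (hNa a c)
  · intro a ha a' c'
    exact hL x v hvK a (ha.trans hb) a' c' trivial trivial

/-- ★★ **THE GRAFT IS PRICE-NEUTRAL (upper bound).**  `RelCert n k Np P → RelCert n m G (P + 2n + 1)`: grafting an arbitrary affine `Tp` and an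
affine scalar `sp` onto `Np` costs at most `2n` (two affine outer factors) `+ 1` (freezing `sp`).  In particular the fat ∧ long ∧ irreducible
graft spaces over `𝔫_k` are CHEAP — not (c)-violators. -/
theorem relCert_graft {P : ℕ} (hT : IsAffine Tp) (hNa : IsAffine Np) (hs : sp.totalDegree ≤ 1) (hR : RelCert n k Np P)
    (G : AffMat n m)
    (hG : G = Matrix.reindex e e (fromBlocks 0
      (fromCols (sp • (1 : Matrix (Fin k) (Fin k) (MvPolynomial (Fin n × Fin n) ℂ))) (Tp + Np))
      (fromRows Tp (-(sp • (1 : Matrix (Fin k) (Fin k) (MvPolynomial (Fin n × Fin n) ℂ))))) 0)) :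
    RelCert n m G (P + 2 * n + 1) := by
  obtain ⟨K, kN, hL, hP⟩ := hR
  refine ⟨K ⊓ frozenDir sp, kN + 2, ledger_graft hT hNa hs hL G hG, ?_⟩
  have h1 := finrank_frozenDir sp
  have h2 := Submodule.finrank_sup_add_finrank_inf_eq K (frozenDir sp)
  have h3 : Module.finrank ℂ ↥(K ⊔ frozenDir sp) ≤ n * n := finrank_dir_le n _
  have h4 : Module.finrank ℂ ↥K ≤ n * n := finrank_dir_le n _
  have e1 : n * (kN + 2) = n * kN + 2 * n := by ring
  rw [e1]
  generalize n * kN = B at hP ⊢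
  generalize n * n = A at hP h1 h3 h4 ⊢
  omega

end Pencil

end Summit.ValiantsHypothesis.ValiantsHypothesis.Theorems.GrenetZeon.BipartiteGraft
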